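import Summits.QuantumFields.YangMills.Theorems.IR.AfPincerUcSupplier
import Summits.QuantumFields.YangMills.Theorems.BalabanLadderIRUnivShellCondSmallBeta
import HarnessLib

/-!
# Clause (i) of the `IR` line `af-pincer-Uc`: LOCALITY (rim reduction) and MONOTONICITY

Helper module for item `stmt-QuantumFields-19354` (crux `IR`, spine route `BalabanLadder`; slot «af-pincer-Uc»
7eb42365f8aba369; `--supports`, closes nothing).  Row «ClauseI LOCALITY & MONOTONICITY» named by the line's lead prover
for the bookkeeping around the one open obligation his reduction isolates — `FixedMesh.ClauseI` for the working class
(`AfPincerUc.Supplier.ClauseIWorkingClassAtOnset`, `Theorems/IR/AfPincerUcOnsetReduction`).  `ClauseI ρ β w n ε Typ`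
asks, for every cell union `Y ⊆ windowCells n` with `0 ∈ Y` and every exterior pair `σ, σ'` typical off `Y` on window +
shell and AGREEING on the window cells off `Y`, that the kernel means of `[0,1]`-valued cylinders of the centre cell under
`γ_{regionEdges w Y}(· | σ)` and `γ_{regionEdges w Y}(· | σ')` differ by at most `ε`.

* §1 GEOMETRY of general frames (cells of width `≥ 1`; tree `CellTempered.Engine.frameCell` / `frame_hC1`): an edge of a
  plaquette touching the cell union of `Y` lies in a cell at index sup-distance `≤ 1` from `Y`; for INTERIOR `Y`
  (every `|yᵢ| ≤ 2n − 1`) such edges are window edges.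
* §2 QUASILOCALITY in equality form WITHOUT second countability (`integral_ymSpecification_congr_of_eqOn`; the tree's
  `dependsOn_integral_ymSpecification` under `[SecondCountableTopology G]`, here via
  `Tempered.integral_ymSpecification_of_continuous`).
* §3 (L1) RIM REDUCTION.  `integral_regionEdges_eq_of_agree_near`: the kernel of `regionEdges w Y` reads the exterior datum
  only on the cells ADJACENT to `Y` (glue `σ'|_Λ` into `σ`, tree `ShellTempered.ymSpecification_congr_off`, then §2);
  `integral_regionEdges_eq_of_interior`: under ClauseI's agreement clause the two integrals COINCIDE when `Y` has no rim
  cell; `clauseI_iff_rim`: for `0 ≤ ε`, clause (i) ⇔ its restriction to cell unions MEETING THE RIM `|yᵢ| = 2n` — the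
  boundary-condition difference it measures sits at cell-distance `2n` from the centre.
* §4 (L2) MONOTONICITY.  `clauseI_antitone_typ`, `clauseI_mono_eps`, the `ClauseIAll` twins, `supCellRarityAt_mono_typ` —
  clause (i) and rarity pull in opposite directions in `Typ` (the supplier's (a)/(b) tension, typed).
* (L3) GAUGE COVARIANCE of ClauseI's influence is the companion module `Theorems/BalabanLadderIRClauseIGauge` (it needs
  `[SecondCountableTopology G]`, the binder of the tree's kernel covariance; nothing in THIS file does).

Pure specification bookkeeping (Georgii 2011 (2.15); Seiler LNP 159 Ch. 2).  No research content: clause (i) itself —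
mixing of the Yang–Mills kernel at the centre cell at mesh `b(β) → ∞` — is NOT claimed.  Conditional chain untouched; not a
gap, not Clay.  No `sorry`; axioms ⊆ {propext, Classical.choice, Quot.sound}.
-/

set_option autoImplicit false

noncomputable section

open MeasureTheory
open Literature.MathematicalPhysics.QuantumLattice
open Literature.Probability.LatticeModels
open Summit.QuantumFields.YangMills.Cruxes.IR.Tempered (cellEdges windowCells regionEdges
  integral_ymSpecification_of_continuous)
open Summit.QuantumFields.YangMills.Cruxes.IR.ShellTempered (windowCellsPlus ymSpecification_congr_off)
open Summit.QuantumFields.YangMills.Cruxes.IR.CellTempered.Engine (frameCell frameCell_eq_iff mem_cellEdges_frameCell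
  frame_hC1 shiftFrame)
open Summit.QuantumFields.YangMills.Cruxes.IR.OnsetFormatsUc (ClauseIAll)
open Summit.QuantumFields.YangMills.Cruxes.IR.AfPincerUc.Supplier (SupCellRarityAt)
open Summit.QuantumFields.YangMills.Cruxes.IR.AfPincerUc.Calibration (windowCells_subset_windowCellsPlus)

namespace Summit.QuantumFields.YangMills.Cruxes.IR.FixedMesh

/-! ## §1 Geometry of general frames: where the plaquettes touching a cell union live -/

section Geometry

/-- The four edges of a plaquette have base points within `[x, x + 1]` coordinatewise, `x` the plaquette's base point. -/
theorem base_le_of_mem_plaquetteEdges {p : ZdPlaquette 4} {e : ZdEdge 4} (he : e ∈ plaquetteEdges p) (i : Fin 4) :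
    p.1 i ≤ e.1 i ∧ e.1 i ≤ p.1 i + 1 := by
  simp only [plaquetteEdges, Finset.mem_insert, Finset.mem_singleton] at he
  rcases he with rfl | rfl | rfl | rfl
  · simp
  · simp only [Pi.add_apply, Pi.single_apply]
    split_ifs <;> omega
  · simp only [Pi.add_apply, Pi.single_apply]
    split_ifs <;> omega
  · simp

variable {w : Fin 4 → ℤ → ℤ}

/-- **Range one ≤ one cell.**  On a frame with cells of width `≥ 1`, every edge of a plaquette touching the cell union
`regionEdges w Y` lies in the cell `frameCell w e`, at index sup-distance `≤ 1` from some cell of `Y`. [folklore] -/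
theorem exists_near_cell_of_mem_plaquetteEdges (hw : ∀ i j, w i j + 1 ≤ w i (j + 1)) {Y : Finset (Fin 4 → ℤ)}
    {p : ZdPlaquette 4} (hp : p ∈ plaquettesTouching (regionEdges w Y)) {e : ZdEdge 4} (he : e ∈ plaquetteEdges p) :
    ∃ y ∈ Y, ∀ k, |frameCell w e k - y k| ≤ 1 := by
  obtain ⟨e₀, he₀⟩ := mem_plaquettesTouching_iff.1 hp
  obtain ⟨he₀p, he₀Y⟩ := Finset.mem_inter.1 he₀
  simp only [Summit.QuantumFields.YangMills.Cruxes.IR.Tempered.regionEdges, Finset.mem_biUnion] at he₀Y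
  obtain ⟨y, hy, he₀y⟩ := he₀Y
  refine ⟨y, hy, fun k => ?_⟩
  have hcell : frameCell w e₀ = y := (frameCell_eq_iff hw e₀ y).2 he₀y
  rw [← hcell]
  refine frame_hC1 hw e e₀ (fun k => ?_) k
  have h1 := base_le_of_mem_plaquetteEdges he k
  have h2 := base_le_of_mem_plaquetteEdges he₀p k
  omega

/-- Every edge of a plaquette touching `regionEdges w Y` lies in the cell union of the cells at index sup-distance `≤ 1`
from `Y`; in particular in `regionEdges w Y'` for every `Y'` containing all such cells. [folklore] -/
theorem plaquetteEdges_subset_regionEdges_of_near (hw : ∀ i j, w i j + 1 ≤ w i (j + 1)) {Y Y' : Finset (Fin 4 → ℤ)}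
    (hY' : ∀ c : Fin 4 → ℤ, (∃ y ∈ Y, ∀ k, |c k - y k| ≤ 1) → c ∈ Y')
    {p : ZdPlaquette 4} (hp : p ∈ plaquettesTouching (regionEdges w Y)) :
    plaquetteEdges p ⊆ regionEdges w Y' := by
  intro e he
  simp only [Summit.QuantumFields.YangMills.Cruxes.IR.Tempered.regionEdges, Finset.mem_biUnion]
  exact ⟨frameCell w e, hY' _ (exists_near_cell_of_mem_plaquetteEdges hw hp he), mem_cellEdges_frameCell hw e⟩

/-- **Interior cell unions are read inside the window.**  If every cell of `Y` is INTERIOR (`|yᵢ| ≤ 2n − 1`), every edge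
of every plaquette touching `regionEdges w Y` is an edge of a window cell. [folklore] -/
theorem plaquetteEdges_subset_regionEdges_windowCells (hw : ∀ i j, w i j + 1 ≤ w i (j + 1)) {n : ℕ}
    {Y : Finset (Fin 4 → ℤ)} (hY : ∀ y ∈ Y, ∀ i, -(2 * (n : ℤ)) + 1 ≤ y i ∧ y i ≤ 2 * (n : ℤ) - 1)
    {p : ZdPlaquette 4} (hp : p ∈ plaquettesTouching (regionEdges w Y)) :
    plaquetteEdges p ⊆ regionEdges w (windowCells n) := by
  refine plaquetteEdges_subset_regionEdges_of_near hw (fun c ⟨y, hy, hc⟩ => ?_) hp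
  simp only [Summit.QuantumFields.YangMills.Cruxes.IR.Tempered.windowCells, Fintype.mem_piFinset, Finset.mem_Icc]
  intro i
  have h1 := abs_le.1 (hc i)
  have h2 := hY y hy i
  constructor <;> omega

/-- A mesh-`b` frame with `b ≥ 1` has cells of width `≥ 1`. -/
theorem width_one_of_isFrame {b : ℕ} (hb : 1 ≤ b) (hw : OnsetFormatsUc.IsFrame b w) :
    ∀ i j, w i j + 1 ≤ w i (j + 1) := fun i j => by
  have h := (hw i j).1
  have hb' : (1 : ℤ) ≤ ((b : ℕ) : ℤ) := by exact_mod_cast hb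
  omega

end Geometry

/-! ## §2 Quasilocality of the Wilson kernel, equality form, no second countability -/

section Kernel

variable {d N : ℕ} {G : Type*} [Group G] [TopologicalSpace G] [IsTopologicalGroup G] [CompactSpace G]
  [MeasurableSpace G] [BorelSpace G] (ρ : G →* Matrix (Fin N) (Fin N) ℂ)

/-- **Quasilocality (equality form).**  Two exterior data that agree on the support `S₀` of a measurable cylinder `F`
and on the edges of the plaquettes touching `Λ` give the same kernel mean `∫ F dγ_Λ` — the Wilson interaction has range
one (Georgii 2011 (2.15)).  Same content as the tree's `dependsOn_integral_ymSpecification`, but proved from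
`Tempered.integral_ymSpecification_of_continuous`, so no `[SecondCountableTopology G]` is needed. [folklore] -/
theorem integral_ymSpecification_congr_of_eqOn (hρ : Continuous ρ) (β : ℝ) (Λ : Finset (ZdEdge d))
    {F : LGConfig d G → ℝ} (hF : Measurable F) {S₀ : Finset (ZdEdge d)} (hFS : IsCylinder F S₀)
    {η η' : LGConfig d G} (h : ∀ e ∈ S₀ ∪ (plaquettesTouching Λ).biUnion plaquetteEdges, η e = η' e) :
    ∫ U, F U ∂(ymSpecification ρ β Λ η) = ∫ U, F U ∂(ymSpecification ρ β Λ η') := by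
  have hS := isCylinder_wilsonBoundaryAction_holds (G := G) ρ Λ
  have hF' : ∀ ζ : ↥Λ → G, F (glueWith Λ ζ η) = F (glueWith Λ ζ η') := fun ζ =>
    hFS fun e he => glueWith_congr_of_eqOn h ζ (Finset.mem_union_left _ (Finset.mem_coe.1 he))
  have hS' : ∀ ζ : ↥Λ → G, wilsonBoundaryAction ρ Λ (glueWith Λ ζ η) =
      wilsonBoundaryAction ρ Λ (glueWith Λ ζ η') := fun ζ =>
    hS fun e he => glueWith_congr_of_eqOn h ζ (Finset.mem_union_right _ (Finset.mem_coe.1 he))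
  rw [integral_ymSpecification_of_continuous ρ hρ β Λ hF η, integral_ymSpecification_of_continuous ρ hρ β Λ hF η']
  simp only [hF', hS']

end Kernel

/-! ## §3 (L1) Locality of the kernel of a cell union in the exterior datum; the rim reduction of clause (i) -/

section Rim

variable {N : ℕ} {G : Type} [Group G] [TopologicalSpace G] [IsTopologicalGroup G] [CompactSpace G]
  [MeasurableSpace G] [BorelSpace G] (ρ : G →* Matrix (Fin N) (Fin N) ℂ) {w : Fin 4 → ℤ → ℤ}

/-- **The kernel of a cell union reads the exterior datum only on the ADJACENT cells.**  On a frame with cells of width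
`≥ 1`, let `σ, σ'` agree on every cell outside `Y` at index sup-distance `≤ 1` from `Y`, and on the part of the support
`S₀` of the measurable cylinder `f` outside `Λ = regionEdges w Y`.  Then `∫ f dγ_Λ(· | σ) = ∫ f dγ_Λ(· | σ')`.
Proof: glue `σ'|_Λ` into `σ` (the kernel does not read its own region, `ymSpecification_congr_off`), then quasilocality
(§2) with the range-one geometry of §1. [folklore] -/
theorem integral_regionEdges_eq_of_agree_near (hρ : Continuous ρ) (β : ℝ) (hw : ∀ i j, w i j + 1 ≤ w i (j + 1))
    (Y : Finset (Fin 4 → ℤ)) {σ σ' : LGConfig 4 G}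
    (hagree : ∀ c : Fin 4 → ℤ, c ∉ Y → (∃ y ∈ Y, ∀ k, |c k - y k| ≤ 1) → ∀ e ∈ cellEdges w c, σ e = σ' e)
    {f : LGConfig 4 G → ℝ} {S₀ : Finset (ZdEdge 4)} (hf : IsCylinder f S₀) (hfm : Measurable f)
    (hS₀ : ∀ e ∈ S₀, e ∉ regionEdges w Y → σ e = σ' e) :
    ∫ U, f U ∂(ymSpecification ρ β (regionEdges w Y) σ) = ∫ U, f U ∂(ymSpecification ρ β (regionEdges w Y) σ') := by
  classical
  set Λ := regionEdges w Y with hΛ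
  -- glue `σ'` inside `Λ` into `σ`
  let σt : LGConfig 4 G := fun e => if e ∈ Λ then σ e else σ' e
  have hoff : ∀ e ∉ Λ, σ' e = σt e := fun e he => by simp [σt, he]
  rw [ymSpecification_congr_off ρ β Λ hoff]
  -- `σ` and `σt` agree on `S₀` and on every edge of a plaquette touching `Λ`
  refine integral_ymSpecification_congr_of_eqOn ρ hρ β Λ hfm hf fun e he => ?_
  by_cases heΛ : e ∈ Λ
  · simp [σt, heΛ]
  · have hσt : σt e = σ' e := by simp [σt, heΛ]
    rw [hσt]
    rcases Finset.mem_union.1 he with he0 | heP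
    · exact hS₀ e he0 heΛ
    · obtain ⟨p, hp, hep⟩ := Finset.mem_biUnion.1 heP
      obtain ⟨y, hy, hnear⟩ := exists_near_cell_of_mem_plaquetteEdges hw hp hep
      have hcY : frameCell w e ∉ Y := by
        intro hc
        exact heΛ (Finset.mem_biUnion.2 ⟨frameCell w e, hc, mem_cellEdges_frameCell hw e⟩)
      exact hagree (frameCell w e) hcY ⟨y, hy, hnear⟩ e (mem_cellEdges_frameCell hw e)

/-- **(L1) RIM REDUCTION — interior cell unions feel nothing.**  In the setting of `ClauseI ρ β w n ε Typ` (a frame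
with cells of width `≥ 1`; ClauseI's own agreement clause on the window cells off `Y`; a measurable cylinder of the centre
cell), if NO cell of `Y` lies on the rim — every `|yᵢ| ≤ 2n − 1` — the two kernel means of clause (i) are EQUAL:
`∫ f dγ_{regionEdges w Y}(· | σ) = ∫ f dγ_{regionEdges w Y}(· | σ')`.  (No typicality, no `0 ∈ Y`, no `Y ⊆ windowCells n`
is used: the cells adjacent to an interior `Y` are window cells, where the data agree.) [folklore] -/
theorem integral_regionEdges_eq_of_interior (hρ : Continuous ρ) (β : ℝ) (hw : ∀ i j, w i j + 1 ≤ w i (j + 1)) {n : ℕ}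
    {Y : Finset (Fin 4 → ℤ)} (hY : ∀ y ∈ Y, ∀ i, -(2 * (n : ℤ)) + 1 ≤ y i ∧ y i ≤ 2 * (n : ℤ) - 1)
    {σ σ' : LGConfig 4 G}
    (hagree : ∀ c ∈ windowCellsPlus n, c ∉ Y → c ∈ windowCells n → ∀ e ∈ cellEdges w c, σ e = σ' e)
    {f : LGConfig 4 G → ℝ} (hf : IsCylinder f (cellEdges w 0)) (hfm : Measurable f) :
    ∫ U, f U ∂(ymSpecification ρ β (regionEdges w Y) σ) = ∫ U, f U ∂(ymSpecification ρ β (regionEdges w Y) σ') := by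
  have hwin : ∀ c : Fin 4 → ℤ, (∃ y ∈ Y, ∀ k, |c k - y k| ≤ 1) → c ∈ windowCells n := by
    rintro c ⟨y, hy, hc⟩
    simp only [Summit.QuantumFields.YangMills.Cruxes.IR.Tempered.windowCells, Fintype.mem_piFinset, Finset.mem_Icc]
    intro i
    have h1 := abs_le.1 (hc i)
    have h2 := hY y hy i
    constructor <;> omega
  refine integral_regionEdges_eq_of_agree_near ρ hρ β hw Y (fun c hcY hnear => ?_) hf hfm (fun e he heΛ => ?_)
  · exact hagree c (windowCells_subset_windowCellsPlus n (hwin c hnear)) hcY (hwin c hnear)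
  · -- an edge of the centre cell outside `Λ`: then `0 ∉ Y`, and `0` is a window cell
    have h0Y : (0 : Fin 4 → ℤ) ∉ Y := fun h0 => heΛ (Finset.mem_biUnion.2 ⟨0, h0, he⟩)
    have h0w : (0 : Fin 4 → ℤ) ∈ windowCells n := by
      simp [Summit.QuantumFields.YangMills.Cruxes.IR.Tempered.windowCells, Fintype.mem_piFinset]
    exact hagree 0 (windowCells_subset_windowCellsPlus n h0w) h0Y h0w e he

/-- The influence of clause (i) VANISHES on interior cell unions: for `Y` with no rim cell the difference of the two
kernel means in `ClauseI` is `0` (so the inequality `≤ ε` there holds iff `0 ≤ ε`, whatever `Typ`). [folklore] -/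
theorem influence_eq_zero_of_interior (hρ : Continuous ρ) (β : ℝ) (hw : ∀ i j, w i j + 1 ≤ w i (j + 1)) {n : ℕ}
    {Y : Finset (Fin 4 → ℤ)} (hY : ∀ y ∈ Y, ∀ i, -(2 * (n : ℤ)) + 1 ≤ y i ∧ y i ≤ 2 * (n : ℤ) - 1)
    {σ σ' : LGConfig 4 G}
    (hagree : ∀ c ∈ windowCellsPlus n, c ∉ Y → c ∈ windowCells n → ∀ e ∈ cellEdges w c, σ e = σ' e)
    {f : LGConfig 4 G → ℝ} (hf : IsCylinder f (cellEdges w 0)) (hfm : Measurable f) :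
    (∫ U, f U ∂(ymSpecification ρ β (regionEdges w Y) σ)) - ∫ U, f U ∂(ymSpecification ρ β (regionEdges w Y) σ') = 0 := by
  rw [integral_regionEdges_eq_of_interior ρ hρ β hw hY hagree hf hfm, sub_self]

/-- A cell union inside the window either has all its cells interior or meets the rim `|yᵢ| = 2n`. -/
theorem interior_or_rim {n : ℕ} {Y : Finset (Fin 4 → ℤ)} (hYw : Y ⊆ windowCells n) :
    (∀ y ∈ Y, ∀ i, -(2 * (n : ℤ)) + 1 ≤ y i ∧ y i ≤ 2 * (n : ℤ) - 1) ∨ ∃ y ∈ Y, ∃ i, |y i| = 2 * (n : ℤ) := by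
  by_cases h : ∀ y ∈ Y, ∀ i, -(2 * (n : ℤ)) + 1 ≤ y i ∧ y i ≤ 2 * (n : ℤ) - 1
  · exact Or.inl h
  · push Not at h
    obtain ⟨y, hy, i, hi⟩ := h
    refine Or.inr ⟨y, hy, i, ?_⟩
    have hyw := hYw hy
    simp only [Summit.QuantumFields.YangMills.Cruxes.IR.Tempered.windowCells, Fintype.mem_piFinset,
      Finset.mem_Icc] at hyw
    have h1 := hyw i
    rw [abs_eq (by positivity)]
    omega

/-- **(L1) `clauseI_iff_rim` — clause (i) has content only on cell unions meeting the rim.**  For `0 ≤ ε` (the slot's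
admissibility `1 ≤ n ∧ 0 ≤ ε ∧ ε · shellCount n ≤ 3/4` carries it) and a frame with cells of width `≥ 1`,
`ClauseI ρ β w n ε Typ` is EQUIVALENT to the same demand restricted to the `Y ⊆ windowCells n`, `0 ∈ Y`, having a cell ON
THE RIM `|yᵢ| = 2n`: on every other admissible `Y` the two integrals coincide (`integral_regionEdges_eq_of_interior`).  The
boundary-condition difference that clause (i) measures sits at cell-distance `2n` from the centre cell. [folklore] -/
theorem clauseI_iff_rim (hρ : Continuous ρ) {β : ℝ} (hw : ∀ i j, w i j + 1 ≤ w i (j + 1)) {n : ℕ} {ε : ℝ} (hε : 0 ≤ ε)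
    {Typ : (Fin 4 → ℤ) → Set (LGConfig 4 G)} :
    ClauseI ρ β w n ε Typ ↔
      ∀ Y : Finset (Fin 4 → ℤ), Y ⊆ windowCells n → (0 : Fin 4 → ℤ) ∈ Y → (∃ y ∈ Y, ∃ i, |y i| = 2 * (n : ℤ)) →
        ∀ σ σ' : LGConfig 4 G,
          (∀ c ∈ windowCellsPlus n, c ∉ Y → σ ∈ Typ c ∧ σ' ∈ Typ c) →
          (∀ c ∈ windowCellsPlus n, c ∉ Y → c ∈ windowCells n → ∀ e ∈ cellEdges w c, σ e = σ' e) →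
          ∀ f : LGConfig 4 G → ℝ, IsCylinder f (cellEdges w 0) → Measurable f → (∀ U, 0 ≤ f U ∧ f U ≤ 1) →
            |(∫ U, f U ∂(ymSpecification ρ β (regionEdges w Y) σ)) -
              ∫ U, f U ∂(ymSpecification ρ β (regionEdges w Y) σ')| ≤ ε := by
  refine ⟨fun hI Y hYw h0 _ => hI Y hYw h0, fun h Y hYw h0 σ σ' htyp hagree f hf hfm hf01 => ?_⟩
  rcases interior_or_rim hYw with hint | hrim
  · rw [influence_eq_zero_of_interior ρ hρ β hw hint hagree hf hfm, abs_zero]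
    exact hε
  · exact h Y hYw h0 hrim σ σ' htyp hagree f hf hfm hf01

/-- **(L1) on mesh-`b` frames**, the binder of the slot (`OnsetFormatsUc.IsFrame b w`, `b ≥ 1`). -/
theorem clauseI_iff_rim_of_isFrame (hρ : Continuous ρ) {β : ℝ} {b : ℕ} (hb : 1 ≤ b) (hwf : OnsetFormatsUc.IsFrame b w)
    {n : ℕ} {ε : ℝ} (hε : 0 ≤ ε) {Typ : (Fin 4 → ℤ) → Set (LGConfig 4 G)} :
    ClauseI ρ β w n ε Typ ↔
      ∀ Y : Finset (Fin 4 → ℤ), Y ⊆ windowCells n → (0 : Fin 4 → ℤ) ∈ Y → (∃ y ∈ Y, ∃ i, |y i| = 2 * (n : ℤ)) →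
        ∀ σ σ' : LGConfig 4 G,
          (∀ c ∈ windowCellsPlus n, c ∉ Y → σ ∈ Typ c ∧ σ' ∈ Typ c) →
          (∀ c ∈ windowCellsPlus n, c ∉ Y → c ∈ windowCells n → ∀ e ∈ cellEdges w c, σ e = σ' e) →
          ∀ f : LGConfig 4 G → ℝ, IsCylinder f (cellEdges w 0) → Measurable f → (∀ U, 0 ≤ f U ∧ f U ≤ 1) →
            |(∫ U, f U ∂(ymSpecification ρ β (regionEdges w Y) σ)) -
              ∫ U, f U ∂(ymSpecification ρ β (regionEdges w Y) σ')| ≤ ε :=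
  clauseI_iff_rim ρ hρ (width_one_of_isFrame hb hwf) hε

/-- With window radius `n ≥ 1` the centre cell alone is interior: clause (i) puts NO constraint at `Y = {0}` beyond
`0 ≤ ε` (the central cell's own kernel does not see the exterior pair at all under the agreement clause). [folklore] -/
theorem influence_eq_zero_singleton_zero (hρ : Continuous ρ) (β : ℝ) (hw : ∀ i j, w i j + 1 ≤ w i (j + 1)) {n : ℕ}
    (hn : 1 ≤ n) {σ σ' : LGConfig 4 G}
    (hagree : ∀ c ∈ windowCellsPlus n, c ∉ ({0} : Finset (Fin 4 → ℤ)) → c ∈ windowCells n →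
      ∀ e ∈ cellEdges w c, σ e = σ' e)
    {f : LGConfig 4 G → ℝ} (hf : IsCylinder f (cellEdges w 0)) (hfm : Measurable f) :
    (∫ U, f U ∂(ymSpecification ρ β (regionEdges w {0}) σ)) - ∫ U, f U ∂(ymSpecification ρ β (regionEdges w {0}) σ') = 0 := by
  refine influence_eq_zero_of_interior ρ hρ β hw (fun y hy i => ?_) hagree hf hfm
  rw [Finset.mem_singleton] at hy
  subst hy
  have hn' : (1 : ℤ) ≤ (n : ℤ) := by exact_mod_cast hn
  simp only [Pi.zero_apply]
  omega

end Rim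

/-! ## §4 (L2) Monotonicity of clause (i) and of single-cell rarity -/

section Monotone

variable {N : ℕ} {G : Type} [Group G] [TopologicalSpace G] [IsTopologicalGroup G] [CompactSpace G]
  [MeasurableSpace G] [BorelSpace G] {ρ : G →* Matrix (Fin N) (Fin N) ℂ} {β : ℝ} {w : Fin 4 → ℤ → ℤ} {n : ℕ}

/-- **Clause (i) is ANTITONE in the typical class**: shrinking `Typ` on the cells of window + shell shrinks the set of
admissible exterior pairs, so the demand weakens — `Typ' c ⊆ Typ c` there gives `ClauseI Typ → ClauseI Typ'`.  (Opposite
to rarity, `supCellRarityAt_mono_typ`: the (a)/(b) tension of the supplier.) -/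
theorem clauseI_antitone_typ {ε : ℝ} {Typ Typ' : (Fin 4 → ℤ) → Set (LGConfig 4 G)}
    (h : ∀ c ∈ windowCellsPlus n, Typ' c ⊆ Typ c) (hI : ClauseI ρ β w n ε Typ) : ClauseI ρ β w n ε Typ' :=
  fun Y hYw h0 σ σ' htyp hagree f hf hfm hf01 =>
    hI Y hYw h0 σ σ' (fun c hc hcY => ⟨h c hc (htyp c hc hcY).1, h c hc (htyp c hc hcY).2⟩) hagree f hf hfm hf01

/-- Clause (i) only reads the typical class on the cells of window + shell: families that agree there are
interchangeable. -/
theorem clauseI_congr_typ {ε : ℝ} {Typ Typ' : (Fin 4 → ℤ) → Set (LGConfig 4 G)}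
    (h : ∀ c ∈ windowCellsPlus n, Typ' c = Typ c) : ClauseI ρ β w n ε Typ ↔ ClauseI ρ β w n ε Typ' :=
  ⟨clauseI_antitone_typ fun c hc => (h c hc).le, clauseI_antitone_typ fun c hc => (h c hc).ge⟩

/-- **Clause (i) is MONOTONE in the threshold**: `ε ≤ ε'` gives `ClauseI ε → ClauseI ε'`. -/
theorem clauseI_mono_eps {ε ε' : ℝ} (h : ε ≤ ε') {Typ : (Fin 4 → ℤ) → Set (LGConfig 4 G)}
    (hI : ClauseI ρ β w n ε Typ) : ClauseI ρ β w n ε' Typ :=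
  fun Y hYw h0 σ σ' htyp hagree f hf hfm hf01 => (hI Y hYw h0 σ σ' htyp hagree f hf hfm hf01).trans h

/-- Clause (i) at every centre (`OnsetFormatsUc.ClauseIAll`) is antitone in the class (everywhere, since every cell is in
some shifted window). -/
theorem clauseIAll_antitone_typ {ε : ℝ} {Typ Typ' : (Fin 4 → ℤ) → Set (LGConfig 4 G)}
    (h : ∀ c, Typ' c ⊆ Typ c) (hI : ClauseIAll ρ β w n ε Typ) : ClauseIAll ρ β w n ε Typ' :=
  fun c₀ => clauseI_antitone_typ (fun c _ => h (c + c₀)) (hI c₀)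

/-- Clause (i) at every centre is monotone in the threshold. -/
theorem clauseIAll_mono_eps {ε ε' : ℝ} (h : ε ≤ ε') {Typ : (Fin 4 → ℤ) → Set (LGConfig 4 G)}
    (hI : ClauseIAll ρ β w n ε Typ) : ClauseIAll ρ β w n ε' Typ :=
  fun c₀ => clauseI_mono_eps h (hI c₀)

end Monotone

end Summit.QuantumFields.YangMills.Cruxes.IR.FixedMesh

namespace Summit.QuantumFields.YangMills.Cruxes.IR.AfPincerUc.Supplier

variable {N : ℕ} {G : Type} [Group G] [TopologicalSpace G] [IsTopologicalGroup G] [CompactSpace G]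
  [MeasurableSpace G] [BorelSpace G] {ρ : G →* Matrix (Fin N) (Fin N) ℂ} {β : ℝ} {w : Fin 4 → ℤ → ℤ}

/-- **Single-cell rarity is MONOTONE in the class**: enlarging `Typ` cellwise keeps the budget —
`Typ c ⊆ Typ' c` gives `SupCellRarityAt Typ δ → SupCellRarityAt Typ' δ`.  (Opposite to clause (i),
`FixedMesh.clauseI_antitone_typ`.) -/
theorem supCellRarityAt_mono_typ {Typ Typ' : (Fin 4 → ℤ) → Set (LGConfig 4 G)} {δ : ℝ}
    (h : ∀ c, Typ c ⊆ Typ' c) (hT : SupCellRarityAt ρ β w Typ δ) : SupCellRarityAt ρ β w Typ' δ :=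
  fun c ζ => (measure_mono (Set.compl_subset_compl.2 (h c))).trans (hT c ζ)

/-- The supplier's two demands pull in opposite directions: for nested classes `Typ₁ ⊆ Typ₂` (cellwise), clause (i) for
the LARGER class and rarity for the SMALLER class give both for each of them. -/
theorem clauseI_and_supCellRarityAt_of_nested {n : ℕ} {ε δ : ℝ} {Typ₁ Typ₂ : (Fin 4 → ℤ) → Set (LGConfig 4 G)}
    (h : ∀ c, Typ₁ c ⊆ Typ₂ c) (hI : FixedMesh.ClauseI ρ β w n ε Typ₂) (hR : SupCellRarityAt ρ β w Typ₁ δ) :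
    (FixedMesh.ClauseI ρ β w n ε Typ₁ ∧ SupCellRarityAt ρ β w Typ₁ δ) ∧
      (FixedMesh.ClauseI ρ β w n ε Typ₂ ∧ SupCellRarityAt ρ β w Typ₂ δ) :=
  ⟨⟨FixedMesh.clauseI_antitone_typ (fun c _ => h c) hI, hR⟩, ⟨hI, supCellRarityAt_mono_typ h hR⟩⟩

end Summit.QuantumFields.YangMills.Cruxes.IR.AfPincerUc.Supplier

end
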